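import Summits.ResolutionOfSingularities.ResolutionOfSingularities.Theorems.MarkedTransferCampaignW46MohWindowSurfaceFreezeCore
import Summits.ResolutionOfSingularities.ResolutionOfSingularities.Theorems.MarkedTransferCampaignW46MohWindowSurfaceFreezeChart
import Summits.ResolutionOfSingularities.ResolutionOfSingularities.Theorems.MarkedTransferCampaignW46MohWindowSurfaceStep
import Literature.AlgebraicGeometry.Resolution.LipmanValuativeQuadraticSequenceProofs
import HarnessLib

/-!
# [OURS · L1 W4.6 rung (iii-2), HEAVY-ROOT SIDE] Surface Moh window — TOP-OF-WINDOW RIGIDITY, scheme level: a window point of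
# residual order `2p − 1` whose residue form has a simple prime factor is NEVER an admitted centre of a sequence that stays in
# the surface-window regime (cell res-hironaka, LADDER-RESOLUTION rung L, D-0089; seat res-L1-s46-pv-5 gen 4; host MarkedTransfer,
# `--supports stmt-ResolutionOfSingularities-16155 --as helper`; statement file `…CampaignW46MohWindowSurface.lean`, res-L1-type-o1)

HONEST FRAMING. Nothing here is a statement of H. Hironaka's manuscript [Hironaka2017] and nothing here asserts that any
statement of it holds. THEOREMS about the OURS regime `CampaignW46.Regime.mohWindowSurface` (o1, `…W46MohWindowSurface.lean` §5:
`E.b = p`, `Sing(E)` finite closed, a COEFFICIENT window presentation `J_ξ = (z^p + Σ_{k ≤ d} a_k x^{d−k} y^k)`, `p < d < 2p`, at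
every singular point) over the shared typed-procedure module; the heavy-root side of res-plan-2's (iii-2) cut (res-D-pv-008's
piece (H)); the scheme-level companion of `…FreezeCore.lean` (ring obstruction) and `…FreezeChart.lean` (the point over a
prescribed prime factor). AI-written; AI review is weaker than expert review. No `sorry`; axioms standard.

WHAT IS PROVED. Let `π : Z′ → Z` be the blow-up of the closed point `ξ ∈ Sing(E)` (every admitted / permissible centre of the
regime is one, `IsPermissibleCentre.exists_eq_singleton_of_isolatedSing`), `J_ξ = (z^p + Σ a_k x^{d−k} y^k)` a coefficient
window presentation with `d = 2p − 1` (the TOP of the window) whose residue polynomial `Σ ā_k X^k ∈ κ(ξ)[X]` has a prime factor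
`π₀` of multiplicity ONE. Then the point `x′ ∈ Z′` over `ξ` in the direction of `π₀` (`…FreezeChart.lean`) lies in `Sing(E′)`
and `J′_{x′}` admits NO coefficient window presentation (`…FreezeCore.lean`: its initial form contains the mixed monomial
`X^{p−1}·P`) — `exists_mem_sing_not_coeffAt_of_simple_root`; hence the transform is NOT in `Regime.mohWindowSurface`
(`not_mohWindowSurface_transform_of_simple_root`), and along every §2.1-permissible sequence all of whose stages lie in the regime
no centre is such a point (`PermissibleRun.not_simple_root_of_mohWindowSurface`). For `p = 2` the window is `{d = 3}`, so EVERY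
window point qualifies unless its residue cubic is the cube of a `κ(ξ)`-rational linear form (up to the root at infinity, covered
by the swapped presentation `(y, x)`): the rung's dynamics at `p = 2` is carried by cube points only, and every TAME state of
characteristic `2` is terminal for the regime (honest (VAC)-type remark on `MohWindowSurfaceTame*` at `p = 2`: no admitted step
keeps the window). DESIGN NOTE: the obstruction is read on the presentation AT `ξ` that the user supplies (any coefficient window
presentation with `d + 1 = 2p`); the regime's own presentation at `ξ` is used only for regularity / embedding dimension.
[ZariskiSamuel1960] [Matsumura1987] [HauserWagner2014] [StacksProject, Tag 0804]
-/

noncomputable section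

set_option linter.dupNamespace false -- mandated namespace of this single-conjunct summit

open CategoryTheory AlgebraicGeometry TopologicalSpace IsLocalRing

namespace Summit.ResolutionOfSingularities.ResolutionOfSingularities.Theorems

namespace CampaignW46

open Literature.AlgebraicGeometry.Resolution
open Literature.AlgebraicGeometry.Hironaka2017.S02Preliminaries
open Literature.AlgebraicGeometry.Hironaka2017.Datum
open Literature.AlgebraicGeometry.Hironaka2017.S16Proof
open Scheme.IdealSheafData
open Polynomial

universe u

/-! ## 1. Ring level: the transform ideal in the `x`-chart over a simple root -/

namespace MohWindowSurface

/-- **[OURS · L1 W4.6 rung (iii-2), heavy side] Ring-level rigidity in the `x`-chart.** `R → L` (`ψ`) the stalk map at a point of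
the blow-up of a window point presented through the Rees chart `0` (`L` a localisation of `R[𝔪/c₀]` at a prime `𝔴` over `𝔪_R`,
`ψ = χ ∘ (c ↦ c/1)`) at which the chart datum of `…FreezeChart.lean` holds (`𝔪_L = (c₀, ρ, e₂)`, `Σ a_k e₁^k ≡ ρ·unit (mod c₀)`
— the point over a SIMPLE prime factor); window equation `g = c₂^p + Σ_{k ≤ d} a_k c₀^{d−k} c₁^k` with `d + 1 = 2p`. Then the
transform ideal `I′ = ((ψ g) : (ψ c₀)^p)` lies in `𝔪_L^p` (the point is SINGULAR for exponent `p`), and if `𝔪_L` has embedding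
dimension `3` then `I′ ≠ (z₁^p + f₁)` for all `z₁ ∈ 𝔪_L`, `f₁ ∈ 𝔪_L^{d₁}`, `d₁ > p` (NO window presentation). NOT a statement of
the manuscript. [folklore] -/
theorem le_pow_and_ne_window_of_chart {R : Type u} [CommRing R] [IsRegularLocalRing R] (p : ℕ) [Fact p.Prime]
    (h3 : (maximalIdeal R).spanFinrank = 3) (c : Fin 3 → R) (hc : Ideal.span (Set.range c) = maximalIdeal R)
    {d : ℕ} (hd : d + 1 = 2 * p) (a : ℕ → R)
    (𝔴 : Ideal (chartRing c 0)) [𝔴.IsPrime] (h𝔴 : 𝔴.comap (chartBase c 0) = maximalIdeal R)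
    (L : Type u) [CommRing L] [IsLocalRing L] [Algebra (chartRing c 0) L] [IsLocalization.AtPrime L 𝔴] [CharP L p]
    (ψ : R →+* L) (hψ : ∀ r, ψ r = (algebraMap (chartRing c 0) L : chartRing c 0 →+* L) (chartBase c 0 r))
    (hdat : ∃ ρ G : L, IsUnit G ∧
      Ideal.span {(algebraMap (chartRing c 0) L : chartRing c 0 →+* L) (chartBase c 0 (c 0)), ρ,
          (algebraMap (chartRing c 0) L : chartRing c 0 →+* L) (chartGen c 0 2)} = maximalIdeal L ∧
      (∑ k ∈ Finset.range (d + 1), (algebraMap (chartRing c 0) L : chartRing c 0 →+* L) (chartBase c 0 (a k)) *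
          (algebraMap (chartRing c 0) L : chartRing c 0 →+* L) (chartGen c 0 1) ^ k) - ρ * G ∈
        Ideal.span {(algebraMap (chartRing c 0) L : chartRing c 0 →+* L) (chartBase c 0 (c 0))})
    {I' : Ideal L}
    (hI' : I' = Submodule.colon (Ideal.span {ψ (c 2 ^ p + ∑ k ∈ Finset.range (d + 1), a k * c 0 ^ (d - k) * c 1 ^ k)})
      ((Ideal.span {ψ (c 0)} ^ p : Ideal L) : Set L)) :
    I' ≤ maximalIdeal L ^ p ∧
      ((maximalIdeal L).spanFinrank = 3 → ∀ {z₁ f₁ : L} {d₁ : ℕ}, z₁ ∈ maximalIdeal L → f₁ ∈ maximalIdeal L ^ d₁ →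
        p < d₁ → I' ≠ Ideal.span {z₁ ^ p + f₁}) := by
  classical
  have hp1 : 1 ≤ p := (Fact.out : p.Prime).one_lt.le
  have hpd : p ≤ d := by omega
  have hdp : d - p = p - 1 := by omega
  set alg : chartRing c 0 →+* L := (algebraMap (chartRing c 0) L : chartRing c 0 →+* L) with halg
  -- `L` is regular, `ψ (c 0)` is a non-zero element of `𝔪_L`
  have hz0 : Ideal.span (Set.range (Fin.append c (fun k : Fin 0 => Fin.elim0 k : Fin 0 → R))) = maximalIdeal R := by
    rw [span_range_append_elim0]; exact hc
  have hd0 : (maximalIdeal R).spanFinrank = 3 + 0 := by rw [h3]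
  have hrsop := isRsopPart_chartFamily_reesChart c 0 (fun k : Fin 0 => Fin.elim0 k) hz0 hd0 𝔴 h𝔴 L
    (a := 0) (fun k : Fin 0 => Fin.elim0 k) (Function.injective_of_subsingleton _) (fun k => Fin.elim0 k)
  haveI hLreg : IsRegularLocalRing L := hrsop.isRegularLocalRing
  haveI : IsDomain L := isDomain_of_isRegularLocalRing L
  have hci0 : ψ (c 0) ≠ 0 := by
    have h0 := hrsop.ne_zero 0
    rw [hψ]; simpa only [chartFamily, Fin.cons_zero] using h0
  -- chart relations and the factorisation of the pulled-back equation
  have hrel : ∀ l, ψ (c l) = ψ (c 0) * alg (chartGen c 0 l) := fun l => by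
    rw [hψ, hψ, halg, ← map_mul, ← reesChartBase_apply_eq_mul_chartGen c 0 l]
  set F : L := ∑ k ∈ Finset.range (d + 1), alg (chartBase c 0 (a k)) * alg (chartGen c 0 1) ^ k with hF
  have hFψ : ∑ k ∈ Finset.range (d + 1), ψ (a k) * alg (chartGen c 0 1) ^ (min k d) = F := by
    rw [hF]; refine Finset.sum_congr rfl fun k hk => ?_
    rw [hψ, min_eq_left (Nat.lt_succ_iff.mp (Finset.mem_range.mp hk))]
  have hfac := map_window_eq_chart ψ (hrel 1) (hrel 2) hpd a (fun k => min k d) (fun k => min_le_right k d)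
  rw [← window_sum_chart_zero, hFψ, hdp] at hfac
  -- the transform ideal is principal, generated by `g₁ = e₂^p + ψ(c₀)^{p-1} F`
  set g₁ : L := alg (chartGen c 0 2) ^ p + ψ (c 0) ^ (p - 1) * F with hg₁
  have hI'eq : I' = Ideal.span {g₁} := by
    rw [hI', hfac, colon_span_pow_mul (mem_nonZeroDivisors_of_ne_zero hci0)]
  -- the datum
  obtain ⟨ρ, G, hGu, hgen, hfρ⟩ := hdat
  rw [← hψ] at hgen hfρ
  refine ⟨?_, fun h3L z₁ f₁ d₁ hz₁ hf₁ hpd₁ heq => ?_⟩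
  · rw [hI'eq, Ideal.span_le, Set.singleton_subset_iff]
    exact window_transform_mem_pow_of_simple_root p hp1 hgen hfρ
  · rw [hI'eq] at heq
    exact span_window_ne_of_simple_root p h3L hgen hGu hfρ hz₁ hf₁ hpd₁ heq

end MohWindowSurface

/-! ## 2. Scheme level: the point of the blow-up over a simple root -/

section Local

variable {X X' : Scheme.{u}} {π : X' ⟶ X}

/-- **[OURS · L1 W4.6 rung (iii-2), heavy side] The point over a simple root is singular with no window presentation** (abstract
blow-up). `π` a blow-up along the ideal of a closed `Y` with `𝓘_{Y,s} = 𝔪_s`; `𝒪_{X,s}` regular of embedding dimension `3` with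
regular system of parameters `c = (x, y, z)`; `J_s = (z^p + Σ_{k ≤ d} a_k x^{d−k} y^k)` with `d + 1 = 2p`; `x′ = q(𝔴)` presented by
the chart morphism `q : Spec R[𝔪/x] → X′` at a prime `𝔴` carrying the simple-root datum of `…FreezeChart.lean`; stalks of `X′` of
characteristic `p`. Then `ord_{x′} J′ ≥ p` for `J′ = (J𝒪_{X′} : 𝓘_E^p)` and `J′_{x′}` has no coefficient window presentation.
[cite: StacksProject, Tag 0804] -/
theorem le_idealOrder_and_not_coeffAt_of_chart [IsLocallyNoetherian X'] {Y : Closeds X} {J : X.IdealSheafData}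
    (p : ℕ) [Fact p.Prime] {d : ℕ} (hd : d + 1 = 2 * p) (x' : X') (s : X) (hs : π x' = s)
    [IsRegularLocalRing (X.presheaf.stalk s)] (h3 : (maximalIdeal (X.presheaf.stalk s)).spanFinrank = 3)
    (c : Fin 3 → X.presheaf.stalk s) (hc : Ideal.span (Set.range c) = maximalIdeal _)
    (hY : stalkIdeal (vanishingIdeal Y) s = maximalIdeal _) (a : ℕ → X.presheaf.stalk s)
    (hJ : stalkIdeal J s = Ideal.span {c 2 ^ p + ∑ k ∈ Finset.range (d + 1), a k * c 0 ^ (d - k) * c 1 ^ k})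
    (q : Spec (.of (chartRing c 0)) ⟶ X') (w : Spec (.of (chartRing c 0))) (hq : q w = x') [IsIso (q.stalkMap w)]
    (hsq : q ≫ π = Spec.map (CommRingCat.ofHom (chartBase c 0)) ≫ X.fromSpecStalk s)
    (hdat : ∀ (L : Type u) [CommRing L] [IsLocalRing L] [Algebra (chartRing c 0) L]
      [IsLocalization.AtPrime L w.asIdeal], ∃ ρ G : L, IsUnit G ∧
        Ideal.span {(algebraMap (chartRing c 0) L : chartRing c 0 →+* L) (chartBase c 0 (c 0)), ρ,
            (algebraMap (chartRing c 0) L : chartRing c 0 →+* L) (chartGen c 0 2)} = maximalIdeal L ∧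
        (∑ k ∈ Finset.range (d + 1), (algebraMap (chartRing c 0) L : chartRing c 0 →+* L) (chartBase c 0 (a k)) *
            (algebraMap (chartRing c 0) L : chartRing c 0 →+* L) (chartGen c 0 1) ^ k) - ρ * G ∈
          Ideal.span {(algebraMap (chartRing c 0) L : chartRing c 0 →+* L) (chartBase c 0 (c 0))})
    [CharP (X'.presheaf.stalk x') p] :
    (p : ℕ∞) ≤ idealOrder (controlledTransform π (vanishingIdeal Y) J p) x' ∧
      ¬ MohWindowSurfaceCoeffAt p (X'.presheaf.stalk x') (stalkIdeal (controlledTransform π (vanishingIdeal Y) J p) x') := by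
  classical
  subst hs
  obtain ⟨χ, hχ₀, hloc, h𝔴₀⟩ :=
    exists_stalk_ringHom_of_chart π x' (CommRingCat.ofHom (chartBase c 0)) q w hq hsq
  have hχ : ∀ r, χ (chartBase c 0 r) = (π.stalkMap x').hom r := fun r => hχ₀ r
  have h𝔴 : w.asIdeal.comap (chartBase c 0) = maximalIdeal (X.presheaf.stalk (π x')) := h𝔴₀
  clear hχ₀ h𝔴₀
  letI := χ.toAlgebra
  haveI : IsLocalization.AtPrime (X'.presheaf.stalk x') w.asIdeal := hloc
  -- `ψ = π^♯_{x′}` (introduced by hand)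
  obtain ⟨ψ, hψ⟩ : ∃ ψ : X.presheaf.stalk (π x') →+* X'.presheaf.stalk x', ψ = (π.stalkMap x').hom := ⟨_, rfl⟩
  have hψa : ∀ r, ψ r = (algebraMap (chartRing c 0) (X'.presheaf.stalk x') :
      chartRing c 0 →+* X'.presheaf.stalk x') (chartBase c 0 r) := fun r => by rw [hψ]; exact (hχ r).symm
  have hrel : ∀ l, ψ (c l) = ψ (c 0) * χ (chartGen c 0 l) := by
    rw [hψ]; exact stalkMap_apply_eq_mul_chartGen 0 χ hχ
  -- the stalk of the transform is the colon `((ψ g) : (ψ c₀)^p)`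
  have hcY : Ideal.span (Set.range c) = stalkIdeal (vanishingIdeal Y) (π x') := hc.trans hY.symm
  have hCmap : (stalkIdeal (vanishingIdeal Y) (π x')).map ψ = Ideal.span {ψ (c 0)} := by
    rw [← hcY, Ideal.map_span_range_eq_span_singleton _ c 0 _ hrel]
  have hstalk : stalkIdeal (controlledTransform π (vanishingIdeal Y) J p) x' =
      Submodule.colon (Ideal.span {ψ (c 2 ^ p + ∑ k ∈ Finset.range (d + 1), a k * c 0 ^ (d - k) * c 1 ^ k)})
        ((Ideal.span {ψ (c 0)} ^ p : Ideal _) : Set _) := by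
    rw [controlledTransform, stalkIdeal_colon, stalkIdeal_pow, stalkIdeal_comap_eq_map_stalkMap,
      stalkIdeal_comap_eq_map_stalkMap, ← hψ, hCmap, hJ, Ideal.map_span, Set.image_singleton]
  obtain ⟨hle, hne⟩ := MohWindowSurface.le_pow_and_ne_window_of_chart p h3 c hc hd a w.asIdeal h𝔴 (X'.presheaf.stalk x')
    ψ hψa (hdat _) hstalk
  refine ⟨(le_idealOrder_iff _ x' p).mpr hle, ?_⟩
  rintro ⟨-, h3L, x₁, y₁, z₁, hxyz₁, d₁, a₁, hpd₁, -, -, hJ₁⟩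
  have hz₁ : z₁ ∈ maximalIdeal _ :=
    hxyz₁ ▸ Ideal.subset_span (Set.mem_insert_of_mem _ (Set.mem_insert_of_mem _ (Set.mem_singleton _)))
  have hf₁ : ∑ k ∈ Finset.range (d₁ + 1), a₁ k * x₁ ^ (d₁ - k) * y₁ ^ k ∈ maximalIdeal _ ^ d₁ := by
    have hle' : Ideal.span {x₁, y₁} ≤ maximalIdeal _ := by
      rw [← hxyz₁]
      refine Ideal.span_mono ?_
      intro b hb
      rcases hb with rfl | rfl
      · exact Set.mem_insert _ _
      · exact Set.mem_insert_of_mem _ (Set.mem_insert _ _)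
    exact Ideal.pow_right_mono hle' d₁ (MohWindowSurface.coeffForm_mem_span_pow x₁ y₁ d₁ a₁)
  exact hne h3L hz₁ hf₁ hpd₁ hJ₁

/-- **[OURS · L1 W4.6 rung (iii-2), heavy side] Existence of the frozen point** (abstract blow-up): with `π`, `Y`, `s`, `c`, `J_s`
as above (`d + 1 = 2p`) and a prime factor `π₀` of the residue polynomial `Σ ā_k X^k` of multiplicity one (`= π₀ · G₀`,
`π₀ ∤ G₀`), some point `x′ ∈ X′` over `s` has `ord_{x′} J′ ≥ p` and `J′_{x′}` without coefficient window presentation — the point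
of the `x`-chart over `π₀` (`…FreezeChart.lean`) under the chart morphism `Spec R[𝔪/x] → X′`
(`IsBlowup.exists_chart_morphism_of_index`). [cite: StacksProject, Tag 0804] -/
theorem exists_le_idealOrder_and_not_coeffAt [IsLocallyNoetherian X'] {Y : Closeds X} (hπ : IsBlowup π (vanishingIdeal Y))
    {J : X.IdealSheafData} (p : ℕ) [Fact p.Prime] {d : ℕ} (hd : d + 1 = 2 * p) {s : X}
    [IsRegularLocalRing (X.presheaf.stalk s)] (h3 : (maximalIdeal (X.presheaf.stalk s)).spanFinrank = 3)
    (c : Fin 3 → X.presheaf.stalk s) (hc : Ideal.span (Set.range c) = maximalIdeal _)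
    (hY : stalkIdeal (vanishingIdeal Y) s = maximalIdeal _) (a : ℕ → X.presheaf.stalk s)
    (hJ : stalkIdeal J s = Ideal.span {c 2 ^ p + ∑ k ∈ Finset.range (d + 1), a k * c 0 ^ (d - k) * c 1 ^ k})
    {π₀ G₀ : (ResidueField (X.presheaf.stalk s))[X]} (hπ₀ : Prime π₀)
    (hF : ∑ k ∈ Finset.range (d + 1), Polynomial.C (residue _ (a k)) * Polynomial.X ^ k = π₀ * G₀) (hG₀ : ¬ π₀ ∣ G₀)
    (hchar : ∀ x' : X', CharP (X'.presheaf.stalk x') p) :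
    ∃ x' : X', π x' = s ∧ (p : ℕ∞) ≤ idealOrder (controlledTransform π (vanishingIdeal Y) J p) x' ∧
      ¬ MohWindowSurfaceCoeffAt p (X'.presheaf.stalk x') (stalkIdeal (controlledTransform π (vanishingIdeal Y) J p) x') := by
  have hcY : Ideal.span (Set.range c) = stalkIdeal (vanishingIdeal Y) s := hc.trans hY.symm
  obtain ⟨q, hqiso, hsq⟩ := hπ.exists_chart_morphism_of_index s c hcY 0
  obtain ⟨𝔴, h𝔴prime, h𝔴m, -, hdat⟩ := MohWindowSurface.exists_prime_over_factor h3 c hc a hπ₀ hF hG₀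
  let w : Spec (.of (chartRing c 0)) := ⟨𝔴, h𝔴prime⟩
  haveI := hqiso w
  haveI := hchar (q w)
  have hpt : Spec.map (CommRingCat.ofHom (chartBase c 0)) w = closedPoint (X.presheaf.stalk s) :=
    PrimeSpectrum.ext h𝔴m
  have hs : π (q w) = s := by
    rw [← Scheme.Hom.comp_apply, hsq, Scheme.Hom.comp_apply, hpt]
    exact Scheme.fromSpecStalk_closedPoint
  exact ⟨q w, hs, le_idealOrder_and_not_coeffAt_of_chart p hd (q w) s hs h3 c hc hY a hJ q w rfl hsq
    (fun L _ _ _ _ => hdat L)⟩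

end Local

/-! ## 3. Campaign level: such a point is never an admitted centre inside `Regime.mohWindowSurface` -/

section Campaign

variable {p : ℕ} [Fact p.Prime] {K : Type u} [Field K] [CharP K p]
variable {A A' : AmbientDatum p K} {E : IdealExponent A.Z}

/-- **[OURS · L1 W4.6 rung (iii-2), heavy side] TOP-OF-WINDOW RIGIDITY.** Let `π : Z′ → Z` be a §2.1-permissible blow-up at `D`
of a state `(A, E)` in `Regime.mohWindowSurface` (so `D = {ξ}`, a closed point of `Sing(E)`), and let
`J_ξ = (z^p + Σ_{k ≤ d} a_k x^{d−k} y^k)` be ANY coefficient window presentation at the centre point with `d + 1 = 2p` whose residue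
polynomial `Σ ā_k X^k` has a prime factor `π₀` of multiplicity one (`= π₀ G₀`, `π₀ ∤ G₀`). Then some singular point `x′` of the
transform `E′` over `ξ` carries NO coefficient window presentation. NOT a statement of the manuscript. [folklore] -/
theorem exists_mem_sing_not_coeffAt_of_simple_root {D : Closeds A.Z} (π : A'.Z ⟶ A.Z)
    (hπ : IsBlowup π (vanishingIdeal D)) (hD : E.IsPermissibleCentre A.hom D) (hRg : Regime.mohWindowSurface A E)
    {ξ : A.Z} (hξD : ξ ∈ (D : Set A.Z)) {x y z : A.Z.presheaf.stalk ξ}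
    (hxyz : Ideal.span {x, y, z} = maximalIdeal _) {d : ℕ} (hd : d + 1 = 2 * p) (a : ℕ → A.Z.presheaf.stalk ξ)
    (hJ : stalkIdeal E.J ξ = Ideal.span {z ^ p + ∑ k ∈ Finset.range (d + 1), a k * x ^ (d - k) * y ^ k})
    {π₀ G₀ : (ResidueField (A.Z.presheaf.stalk ξ))[X]} (hπ₀ : Prime π₀)
    (hF : ∑ k ∈ Finset.range (d + 1), Polynomial.C (residue _ (a k)) * Polynomial.X ^ k = π₀ * G₀) (hG₀ : ¬ π₀ ∣ G₀) :
    ∃ x' ∈ (E.transform π D).sing, π.base x' = ξ ∧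
      ¬ MohWindowSurfaceCoeffAt p (A'.Z.presheaf.stalk x') (stalkIdeal (E.transform π D).J x') := by
  classical
  obtain ⟨ξ₀, hξ₀S, hξ₀cl, hDξ₀⟩ := IsPermissibleCentre.exists_eq_singleton_of_isolatedSing hD ⟨hRg.2.1, hRg.2.2.1⟩
  have hξ : ξ = ξ₀ := by simpa [hDξ₀] using hξD
  subst hξ
  obtain ⟨hb, -, -, hwin⟩ := hRg
  obtain ⟨hRreg, h3, -⟩ := hwin _ hξ₀S
  haveI := hRreg
  haveI : IsLocallyNoetherian A'.Z := by
    haveI := A'.smooth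
    exact LocallyOfFiniteType.isLocallyNoetherian A'.hom
  have hY : stalkIdeal (vanishingIdeal D) ξ = maximalIdeal (A.Z.presheaf.stalk ξ) := by
    apply stalkIdeal_vanishingIdeal_eq_maximalIdeal_of_closure_eq
    rw [hDξ₀, hξ₀cl.closure_eq]
  set c : Fin 3 → A.Z.presheaf.stalk ξ := ![x, y, z] with hc_def
  have hc : Ideal.span (Set.range c) = maximalIdeal _ := by rw [hc_def, MohWindowSurface.range_vec3]; exact hxyz
  have hJc : stalkIdeal E.J ξ = Ideal.span {c 2 ^ p + ∑ k ∈ Finset.range (d + 1), a k * c 0 ^ (d - k) * c 1 ^ k} := by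
    rw [hJ]; rfl
  obtain ⟨x', hx', hle, hnot⟩ := exists_le_idealOrder_and_not_coeffAt hπ p hd h3 c hc hY a hJc hπ₀ hF hG₀
    (fun x' => Lem16p11Proof.charP_stalk A π x')
  refine ⟨x', ?_, hx', ?_⟩
  · show ((E.transform π D).b : ℕ∞) ≤ idealOrder (controlledTransform π (vanishingIdeal D) E.J E.b) x'
    rw [show (E.transform π D).b = E.b from rfl, hb]
    exact hle
  · rw [show stalkIdeal (E.transform π D).J x' = stalkIdeal (controlledTransform π (vanishingIdeal D) E.J E.b) x' from rfl, hb]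
    exact hnot

/-- **[OURS · L1 W4.6 rung (iii-2), heavy side] Blowing up such a point LEAVES the regime**: under the hypotheses of
`exists_mem_sing_not_coeffAt_of_simple_root` the transform `(A′, E′)` is not in `Regime.mohWindowSurface` (a singular point
without coefficient window presentation). NOT a statement of the manuscript. [folklore] -/
theorem not_mohWindowSurface_transform_of_simple_root {D : Closeds A.Z} (π : A'.Z ⟶ A.Z)
    (hπ : IsBlowup π (vanishingIdeal D)) (hD : E.IsPermissibleCentre A.hom D) (hRg : Regime.mohWindowSurface A E)
    {ξ : A.Z} (hξD : ξ ∈ (D : Set A.Z)) {x y z : A.Z.presheaf.stalk ξ}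
    (hxyz : Ideal.span {x, y, z} = maximalIdeal _) {d : ℕ} (hd : d + 1 = 2 * p) (a : ℕ → A.Z.presheaf.stalk ξ)
    (hJ : stalkIdeal E.J ξ = Ideal.span {z ^ p + ∑ k ∈ Finset.range (d + 1), a k * x ^ (d - k) * y ^ k})
    {π₀ G₀ : (ResidueField (A.Z.presheaf.stalk ξ))[X]} (hπ₀ : Prime π₀)
    (hF : ∑ k ∈ Finset.range (d + 1), Polynomial.C (residue _ (a k)) * Polynomial.X ^ k = π₀ * G₀) (hG₀ : ¬ π₀ ∣ G₀) :
    ¬ Regime.mohWindowSurface A' (E.transform π D) := by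
  intro hRg'
  obtain ⟨x', hx'S, -, hnot⟩ := exists_mem_sing_not_coeffAt_of_simple_root π hπ hD hRg hξD hxyz hd a hJ hπ₀ hF hG₀
  obtain ⟨hb', -, -, hwin'⟩ := hRg'
  have := hwin' x' hx'S
  rw [hb'] at this
  exact hnot this

/-- **[OURS · L1 W4.6 rung (iii-2), heavy side] Along a permissible sequence inside the regime no centre is such a point.** For a
§2.1-permissible sequence `r` all of whose stages lie in `Regime.mohWindowSurface`, NO centre `D_k` contains a point with a
coefficient window presentation of exponent `2p − 1` whose residue polynomial has a prime factor of multiplicity one. NOT a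
statement of the manuscript. [folklore] -/
theorem PermissibleRun.not_simple_root_of_mohWindowSurface (r : PermissibleRun p K)
    (hr : ∀ k, Regime.mohWindowSurface (r.A k) (r.E k)) (k : ℕ) {ξ : (r.A k).Z} (hξD : ξ ∈ (r.D k : Set (r.A k).Z))
    {x y z : (r.A k).Z.presheaf.stalk ξ} (hxyz : Ideal.span {x, y, z} = maximalIdeal _) {d : ℕ} (hd : d + 1 = 2 * p)
    (a : ℕ → (r.A k).Z.presheaf.stalk ξ)
    (hJ : stalkIdeal (r.E k).J ξ = Ideal.span {z ^ p + ∑ j ∈ Finset.range (d + 1), a j * x ^ (d - j) * y ^ j})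
    {π₀ G₀ : (ResidueField ((r.A k).Z.presheaf.stalk ξ))[X]} (hπ₀ : Prime π₀)
    (hF : ∑ j ∈ Finset.range (d + 1), Polynomial.C (residue _ (a j)) * Polynomial.X ^ j = π₀ * G₀) : π₀ ∣ G₀ := by
  by_contra hG₀
  have key : ∀ (E₁ : IdealExponent (r.A (k + 1)).Z), Regime.mohWindowSurface (r.A (k + 1)) E₁ →
      E₁ = (r.E k).transform (r.π k) (r.D k) → False := by
    intro E₁ h₁ heq
    subst heq
    exact not_mohWindowSurface_transform_of_simple_root (r.π k) (r.blowup k) (r.permissible k) (hr k) hξD hxyz hd a hJ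
      hπ₀ hF hG₀ h₁
  exact key (r.E (k + 1)) (hr (k + 1)) (r.E_succ k)

end Campaign

end CampaignW46

end Summit.ResolutionOfSingularities.ResolutionOfSingularities.Theorems

end
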